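import Summits.Ventures.PercRepro.GenQFlatFacts

/-!
# PercRepro — the coloop pairs of a level are counted by the hyperplane traces (night-4, gen 7)

For `S ⊆ G` of rank `q` and `x` a coloop of `S`, the set `S ∖ x` has rank `q − 1` and its closure is a
rank-`(q − 1)` flat `H` (the hyperplane of the coloop) with `x ∉ H`; conversely every rank-`(q − 1)` flat `H`,
every `T ⊆ H ∩ G` spanning `H` and every `x ∈ G ∖ H` give the rank-`q` set `T ∪ {x}` with `x` a coloop.
Hence the EXACT identity — the row (H1) of the hyperplane-trace block of the profile LP (sheet §62 (k4)):

`Σ_{S ∈ R_q(G), |G ∖ S| = k} m(S) = Σ_{H ∈ flatsQ M (q−1)} |G ∖ H| · #{T ⊆ H ∩ G : |T| = |G| − k − 1, rk T = q − 1}`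

(`sum_mTr_level_eq_sum_hyperplanes`).  The profile rows (P1)–(P3), (L4) only bound the coloop pairs of a level;
this identity ties them to the hyperplane profile of `G`.  Imports `GenQFlatFacts`.
-/
namespace PercRepro.Night4

open Finset ThmH SixFour GenQ PerFlat Star

variable {α : Type*} [DecidableEq α] {M : Matroid α} [M.Finite]

/-- The rank-`r` `j`-subsets of the trace of the flat `H` on `G`: `#{T ⊆ H ∩ G : |T| = j, rk T = r}`. -/
noncomputable def spF (M : Matroid α) [M.Finite] (G H : Finset α) (r j : ℕ) : ℕ :=
  (((H ∩ G).powersetCard j).filter (fun T : Finset α => M.eRk (T : Set α) = (r : ℕ∞))).card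

/-- The level-`k` sets of `G`: `{S ∈ R_q(G) : |G ∖ S| = k}`. -/
noncomputable def levelSets (M : Matroid α) [M.Finite] (G : Finset α) (q k : ℕ) : Finset (Finset α) :=
  (Rq M G q).filter (fun S : Finset α => (G \ S).card = k)

/-- Membership in `levelSets`. -/
theorem mem_levelSets {G S : Finset α} {q k : ℕ} :
    S ∈ levelSets M G q k ↔ S ∈ Rq M G q ∧ (G \ S).card = k := by
  unfold levelSets
  rw [Finset.mem_filter]

/-- Removing a coloop from a rank-`q` set leaves rank `q − 1`. -/
theorem eRk_erase_of_mem_coloopsOf {G S : Finset α} {q : ℕ} (hG : G ⊆ gr M) (hS : S ∈ Rq M G q)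
    {x : α} (hx : x ∈ coloopsOf M S) : M.eRk ((S.erase x : Finset α) : Set α) = ((q - 1 : ℕ) : ℕ∞) := by
  have hS' := mem_Rq.1 hS
  have hx' := mem_coloopsOf.1 hx
  have hxE : x ∈ M.E := by
    rw [← coe_gr M, Finset.mem_coe]
    exact hG (hS'.1 hx'.1)
  have h1 : M.eRk (insert x ((S.erase x : Finset α) : Set α)) = M.eRk ((S.erase x : Finset α) : Set α) + 1 :=
    Matroid.eRk_insert_eq_add_one ⟨hxE, hx'.2⟩
  rw [← Finset.coe_insert, Finset.insert_erase hx'.1, hS'.2] at h1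
  obtain ⟨a, ha⟩ := exists_eRk_eq_nat (M := M) (S.erase x)
  rw [ha] at h1 ⊢
  have h2 : q = a + 1 := by exact_mod_cast h1
  have h3 : a = q - 1 := by omega
  rw [h3]

/-- The hyperplane of a coloop: `cl(S ∖ x)` is a rank-`(q − 1)` flat. -/
theorem clF_erase_mem_flatsQ_of_mem_coloopsOf {G S : Finset α} {q : ℕ} (hG : G ⊆ gr M) (hS : S ∈ Rq M G q)
    {x : α} (hx : x ∈ coloopsOf M S) : clF M (S.erase x) ∈ flatsQ M (q - 1) := by
  rw [mem_flatsQ, ← Finset.coe_subset, coe_clF, coe_gr]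
  exact ⟨M.closure_subset_ground _, M.isFlat_closure _,
    by rw [M.eRk_closure_eq, eRk_erase_of_mem_coloopsOf hG hS hx]⟩

/-- Adding a point outside a rank-`(q − 1)` flat to a rank-`(q − 1)` subset of it gives a rank-`q` set with the point
as a coloop. -/
theorem insert_mem_Rq_of_flat {G H T : Finset α} {q : ℕ} (hG : G ⊆ gr M) (hH : H ∈ flatsQ M (q - 1))
    (hT : T ⊆ H) (hTG : T ⊆ G) (hrT : M.eRk (T : Set α) = ((q - 1 : ℕ) : ℕ∞)) (hq : 1 ≤ q) {x : α}
    (hxG : x ∈ G) (hxH : x ∉ H) :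
    insert x T ∈ Rq M G q ∧ x ∈ coloopsOf M (insert x T) := by
  have hH' := mem_flatsQ.1 hH
  have hxE : x ∈ M.E := by
    rw [← coe_gr M, Finset.mem_coe]
    exact hG hxG
  have hxcl : x ∉ M.closure (T : Set α) := by
    intro hcl
    have h1 : M.closure (T : Set α) ⊆ M.closure (H : Set α) :=
      M.closure_subset_closure (Finset.coe_subset.2 hT)
    rw [hH'.2.1.closure] at h1
    exact hxH (Finset.mem_coe.1 (h1 hcl))
  have hxT : x ∉ T := fun h => hxH (hT h)
  refine ⟨mem_Rq.2 ⟨Finset.insert_subset hxG hTG, ?_⟩, mem_coloopsOf.2 ⟨Finset.mem_insert_self x T, ?_⟩⟩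
  · rw [Finset.coe_insert, Matroid.eRk_insert_eq_add_one ⟨hxE, hxcl⟩, hrT]
    have : q = (q - 1) + 1 := by omega
    conv_rhs => rw [this]
    push_cast
    rfl
  · rw [Finset.erase_insert hxT]
    exact hxcl

/-- **(H1)** The coloop pairs of level `k` are counted by the hyperplane traces:
`Σ_{S ∈ R_q(G), |G ∖ S| = k} m(S) = Σ_{H ∈ flatsQ (q−1)} |G ∖ H| · #{T ⊆ H ∩ G : |T| = |G| − k − 1, rk T = q − 1}`. -/
theorem sum_mTr_level_eq_sum_hyperplanes {G : Finset α} {q k : ℕ} (hG : G ⊆ gr M)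
    (hq : 1 ≤ q) (hk : k + 1 ≤ G.card) :
    ∑ S ∈ levelSets M G q k, mTr M S
      = ∑ H ∈ flatsQ M (q - 1), (G \ H).card * spF M G H (q - 1) (G.card - k - 1) := by
  classical
  have hL : ∑ S ∈ levelSets M G q k, mTr M S
      = ((levelSets M G q k).sigma (fun S => coloopsOf M S)).card := by
    rw [Finset.card_sigma]
    rfl
  have hR : ∑ H ∈ flatsQ M (q - 1), (G \ H).card * spF M G H (q - 1) (G.card - k - 1)
      = ((flatsQ M (q - 1)).sigma (fun H => (G \ H) ×ˢ
          ((H ∩ G).powersetCard (G.card - k - 1)).filter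
            (fun T : Finset α => M.eRk (T : Set α) = ((q - 1 : ℕ) : ℕ∞)))).card := by
    rw [Finset.card_sigma]
    refine Finset.sum_congr rfl (fun H _ => ?_)
    rw [Finset.card_product]
    rfl
  rw [hL, hR]
  refine Finset.card_bij' (fun p _ => ⟨clF M (p.1.erase p.2), (p.2, p.1.erase p.2)⟩)
    (fun p _ => ⟨insert p.2.1 p.2.2, p.2.1⟩) ?_ ?_ ?_ ?_
  · rintro ⟨S, x⟩ hp
    rw [Finset.mem_sigma] at hp
    obtain ⟨hS, hx⟩ := hp
    have hS' := mem_levelSets.1 hS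
    have hSR := mem_Rq.1 hS'.1
    have hx' := mem_coloopsOf.1 hx
    rw [Finset.mem_sigma]
    refine ⟨clF_erase_mem_flatsQ_of_mem_coloopsOf hG hS'.1 hx, ?_⟩
    rw [Finset.mem_product]
    refine ⟨?_, ?_⟩
    · rw [Finset.mem_sdiff]
      refine ⟨hSR.1 hx'.1, ?_⟩
      rw [mem_clF]
      exact hx'.2
    · rw [Finset.mem_filter, Finset.mem_powersetCard]
      refine ⟨⟨?_, ?_⟩, eRk_erase_of_mem_coloopsOf hG hS'.1 hx⟩
      · intro y hy
        rw [Finset.mem_inter]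
        refine ⟨?_, hSR.1 (Finset.erase_subset x S hy)⟩
        rw [mem_clF]
        refine M.subset_closure _ ?_ (Finset.mem_coe.2 hy)
        rw [← coe_gr M]
        exact Finset.coe_subset.2 ((Finset.erase_subset x S).trans (hSR.1.trans hG))
      · rw [Finset.card_erase_of_mem hx'.1]
        have h1 := Finset.card_sdiff_of_subset hSR.1
        have h2 := Finset.card_le_card hSR.1
        omega
  · rintro ⟨H, x, T⟩ hp
    rw [Finset.mem_sigma, Finset.mem_product, Finset.mem_sdiff, Finset.mem_filter,
      Finset.mem_powersetCard] at hp
    obtain ⟨hH, ⟨hxG, hxH⟩, ⟨hTHG, hTcard⟩, hrT⟩ := hp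
    have hTH : T ⊆ H := hTHG.trans Finset.inter_subset_left
    have hTG : T ⊆ G := hTHG.trans Finset.inter_subset_right
    have hmain := insert_mem_Rq_of_flat hG hH hTH hTG hrT hq hxG hxH
    rw [Finset.mem_sigma]
    refine ⟨mem_levelSets.2 ⟨hmain.1, ?_⟩, hmain.2⟩
    have hxT : x ∉ T := fun h => hxH (hTH h)
    rw [Finset.card_sdiff_of_subset (Finset.insert_subset hxG hTG), Finset.card_insert_of_notMem hxT, hTcard]
    omega
  · rintro ⟨S, x⟩ hp
    rw [Finset.mem_sigma] at hp
    have hx' := mem_coloopsOf.1 hp.2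
    exact Sigma.ext (Finset.insert_erase hx'.1) HEq.rfl
  · rintro ⟨H, x, T⟩ hp
    rw [Finset.mem_sigma, Finset.mem_product, Finset.mem_sdiff, Finset.mem_filter,
      Finset.mem_powersetCard] at hp
    obtain ⟨hH, ⟨hxG, hxH⟩, ⟨hTHG, _⟩, hrT⟩ := hp
    have hH' := mem_flatsQ.1 hH
    have hTH : T ⊆ H := hTHG.trans Finset.inter_subset_left
    have hxT : x ∉ T := fun h => hxH (hTH h)
    have hcl : clF M T = H := by
      apply Finset.coe_injective
      rw [coe_clF]
      have h1 : M.closure (T : Set α) = M.closure (H : Set α) :=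
        (M.isRkFinite_of_finite (Finset.finite_toSet T)).closure_eq_closure_of_subset_of_eRk_ge_eRk
          (Finset.coe_subset.2 hTH) (by rw [hrT, hH'.2.2])
      rw [h1, hH'.2.1.closure]
    simp only [Finset.erase_insert hxT, hcl]

end PercRepro.Night4
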